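import Literature.Geometry.Lorentzian.KerrHorizonCausality
import Literature.Geometry.Lorentzian.KerrHawkingField
import HarnessLib

/-!
# Axisymmetry versus superradiance: the `T`-energy density of axisymmetric fields on Kerr is
# non-negative outside the horizon, and so is the `T`-flux through the horizon
# (Aretakis, JFA 263 (2012), §5.1, Prop. 5.1.1)

(family `gr`; first brick of the printed proof of the named fact
`Literature.Barriers.FinalStateConjecture.Aretakis2012_pointwiseDecay` — Aretakis 2012, Thm. 5 —
in the coefficient-field vocabulary of `KerrEnergyIdentity.lean`; namespace
`Literature.Geometry.Lorentzian.Kerr`)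

Aretakis (*Decay of axisymmetric solutions of the wave equation on extreme Kerr backgrounds*,
J. Funct. Anal. 263 (2012) 2770–2831 = arXiv:1110.2006), §5.1 "Axisymmetry vs Superradiance",
proves, for the whole Kerr family `|a| ≤ M`:

* **Lemma 5.1.1**: for a vector `n` orthogonal to the axial Killing field `Φ` and an axisymmetric
  function `ψ` (`Φψ = 0`), `J^Φ_μ[ψ] n^μ = 0`;
* **Prop. 5.1.1**: for an axisymmetric spacelike hypersurface `Σ` with future unit normal `n_Σ`
  and an axisymmetric `ψ`, `J^T_μ[ψ] n^μ_Σ ≥ 0` ("superradiance is absent if `ψ` is assumed to be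
  axisymmetric"; proof: `J^T n = J^{T + ω(p)Φ} n ≥ 0` for `ω(p)` making `T + ω(p)Φ` future causal);
* the remark after it: in the extreme case
  `J^T_μ[ψ] n^μ_{Σ₀} ∼ (Tψ)² + (1 − M/r)²(Yψ)² + |∇̸ψ|²` for `r ≤ R`, and "similarly, we obtain
  `∫_{𝓗⁺} J^T_μ[ψ] n^μ_{𝓗⁺} ≥ 0`", whence (Prop. 5.1.2, `K^T = 0`) the degenerate `T`-energy
  through an axisymmetric spacelike foliation is non-increasing.

This file **proves** these statements for the prelude's Kerr metric `g_{M,a} = η + 2H ℓ ⊗ ℓ` in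
ingoing Kerr–Schild Cartesian coordinates (`KerrSchild.lean`), for the leaves `{t* = const}` of
the chart (which are axisymmetric: `t*` is `Φ`-invariant) and the energy current
`(J^T)^μ = Kerr.tCurrent M a w x μ` of the Killing multiplier `T = ∂_{t*} = ∂₀`
(`KerrEnergyIdentity.lean`), *quantitatively and by a direct algebraic route* which exhibits the
degenerate weight: writing `p_μ = ∂_μ w(x)`, `s = ℓ⃗ · ∇w = ∑_{i=1}^3 ℓ_i p_i`, `r = Kerr.radius a x`,
`Σ = Kerr.blSigma a x⃗ = r² + a² x₃²/r²`, `Δ = r² − 2Mr + a²`, `2H = 2Mr/Σ`, and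
`u⃗ = (r x₁/(r² + a²), r x₂/(r² + a²), x₃/r)` (the part of `ℓ⃗` orthogonal to `∂_{φ*}`;
`ℓ⃗ = u⃗ − (a/(r² + a²)) (−x₂, x₁, 0)`, `|u⃗|² = Σ/(r² + a²)`, `∇r = ((r² + a²)/Σ) u⃗`):

* `Kerr.fderiv_axialVector` — `dw_x(x₁∂₂ − x₂∂₁) = x₁ p₂ − x₂ p₁`, so that axisymmetry at `x`
  (`Φw(x) = 0`, `Φ = Kerr.axialVector`) is the linear constraint `x₁ p₂ = x₂ p₁`;
* `Kerr.neg_tCurrent_zero_eq` — the `T`-energy density through the leaves in closed form,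
  `e[w] := −(J^T)⁰ = ½ (1 + 2H) p₀² + ½ |p⃗|² − H s²` (no axisymmetry; cf.
  `KerrSchild.Background.tEnergyDensity_eq` for generalised backgrounds);
* `Kerr.sq_nullSpatial_le_of_axisymmetric` — **the Cauchy–Schwarz inequality behind Prop. 5.1.1**:
  under `x₁ p₂ = x₂ p₁`, `(r² + a²) s² ≤ Σ |p⃗|²` (because then `s = u⃗ · p⃗` and
  `|u⃗|² = Σ/(r² + a²)`);
* `Kerr.neg_tCurrent_zero_ge_of_axisymmetric` — **Prop. 5.1.1, quantitative form**: for `M ≥ 0`,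
  `r > 0` and `Φw(x) = 0`,
  `½ (1 + 2H) (∂₀w)² + (Δ/(2(r² + a²))) |∇w|² ≤ e[w]`
  (indeed `e[w]` minus the left side is `(Mr/((r² + a²)Σ)) (Σ|p⃗|² − (r² + a²)s²) ≥ 0`); the weight
  `Δ/(r² + a²) = (r − M)²/(r² + M²)` for `a = M` is the printed degeneration `(1 − M/r)²` of the
  transversal derivative at `𝓗⁺` (only the component of `∇w` along `u⃗ ∝ ∇r` degenerates:
  `e[w] = ½(1 + 2H)p₀² + ½(|p⃗|² − ((r² + a²)/Σ)(u⃗·p⃗)²) + (Δ/(2Σ))(u⃗·p⃗)²`);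
* `Kerr.neg_tCurrent_zero_nonneg_of_axisymmetric`, `Kerr.neg_tCurrent_zero_nonneg_of_rPlus_le` —
  **Prop. 5.1.1**: `0 ≤ e[w]` wherever `Δ(r) ≥ 0`, in particular at every point with `r ≥ r₊`
  when `|a| ≤ M` (including the horizon and the extremal case `|a| = M`; in the ergoregion
  `{2H > 1}`, whose closure contains `𝓗⁺`, the multiplier `T` is spacelike and `e[w]` is indefinite
  on general `w`);
* `Kerr.sum_tCurrent_mul_fderiv_radius` — the flux of `J^T` through the level sets of `r`:
  `∑_μ (J^T)^μ ∂_μ r = ∂₀w · (2H (∂₀w − s) + ∇r · ∇w)` for `r > 0` (`∂₀ r = 0`, `ℓ⃗ · ∇r = 1`);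
* `Kerr.sum_tCurrent_mul_fderiv_radius_of_radius_eq_rPlus` — **on the horizon** `{r = r₊}`
  (`|a| ≤ M`, `M > 0`): `∑_μ (J^T)^μ ∂_μ r = 2H (Tw)(Kw)` with `K = T + ω₊Φ` the Hawking field
  (`Kerr.hawkingVector`, `ω₊ = a/(2Mr₊)`; here `g♯dr = 2H K` is the null generator), hence
  `= 2H (∂₀w)² ≥ 0` for axisymmetric `w` (`Kerr.sum_tCurrent_mul_fderiv_radius_of_axisymmetric`,
  `Kerr.sum_tCurrent_mul_fderiv_radius_nonneg_of_axisymmetric`) — the sign of the horizon term in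
  the `T`-energy identity on `{r ≥ r₊} ∩ {τ₁ ≤ t* ≤ τ₂}` (outward conormal of the exterior at `𝓗⁺`
  is `−dr`), i.e. Aretakis's "`∫_{𝓗⁺} J^T_μ n^μ_{𝓗⁺} ≥ 0`".

Everything is pointwise and algebraic in the first jet `p = dw(x)`; the hypotheses are `r > 0`
(the chart) and, where stated, `M ≥ 0`, `Δ ≥ 0` / `r ≥ r₊`, `|a| ≤ M`. Nothing here is in Mathlib
(no Lorentzian geometry); the tree had the indefinite closed form and the coercivity of `e[w]` off
the ergoregion (`KerrSchild.Background.tEnergyDensity_ge`) and the timelike span `T + ωΦ` for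
`|a| < M` off the horizon (`KerrTimelikeSpan.lean`), but not the axisymmetric sign, which is what
the degenerate-energy estimates of Aretakis 2012 (Prop. 5.1.2, Thms. 1–5) start from.

## References

* S. Aretakis, *Decay of axisymmetric solutions of the wave equation on extreme Kerr
  backgrounds*, J. Funct. Anal. 263 (2012) 2770–2831, arXiv:1110.2006: §5.1, Lemma 5.1.1,
  Prop. 5.1.1, the display `J^T n ∼ (Tψ)² + (1 − M/r)²(Yψ)² + |∇̸ψ|²`, Prop. 5.1.2
  (key `Aretakis2012`).
* M. Dafermos, I. Rodnianski, Y. Shlapentokh-Rothman, arXiv:1402.7034 = Ann. of Math. 183 (2016),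
  §2.2.2 (`T`, `Φ`, `K = T + ω₊Φ`), §2.3.1–§2.3.2 (the currents `J^V` and the signs of their
  fluxes) (key `DafermosRodnianskiShlapentokhrothman2014`).
* M. Visser, *The Kerr spacetime: a brief introduction*, arXiv:0706.0622, (33)–(35)
  (`H`, `ℓ`, the Kerr–Schild radius) (key `arXiv07060622`).
-/

noncomputable section

open scoped Topology

namespace Literature.Geometry.Lorentzian.Kerr

/-! ### Axisymmetry at a point: the constraint `x₁ p₂ = x₂ p₁` -/

/-- `dw_x(x₁ ∂₂ − x₂ ∂₁) = x₁ ∂₂w − x₂ ∂₁w` (linearity of the Fréchet derivative), so that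
`Φw(x) = 0` for the axial field `Φ = x₁∂₂ − x₂∂₁` (`Kerr.axialVector`) is the linear constraint
`x₁ p₂ = x₂ p₁` on `p = dw(x)`. Aretakis, JFA 263 (2012), §5.1 ("axisymmetric function, i.e. such
that `Φψ = 0`"). [folklore] -/
theorem fderiv_axialVector (w : E4 → ℝ) (x : E4) :
    fderiv ℝ w x (axialVector x) =
      x 1 * fderiv ℝ w x (E4.basisVector 2) - x 2 * fderiv ℝ w x (E4.basisVector 1) := by
  simp only [axialVector, map_sub, map_smul, smul_eq_mul]

/-! ### The `T`-energy density through the leaves `{t* = const}` in closed form -/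

/-- **Closed form of the `T`-energy density of the Kerr–Schild leaves.** With `p_μ = ∂_μ w(x)`,
`s = ℓ₁p₁ + ℓ₂p₂ + ℓ₃p₃` and `H` the Kerr–Schild scalar,
`−(J^T)⁰ = ½ (1 + 2H) p₀² + ½ (p₁² + p₂² + p₃²) − H s²`
(`g^{00} = −1 − 2H`, `g^{0i} = 2Hℓ_i`, `g^{ij} = δ_{ij} − 2Hℓ_iℓ_j`). Valid at every point of `E4`
(no hypothesis on `r`). Aretakis, JFA 263 (2012), §5.1 (the flux `J^T_μ n^μ`); cf.
`KerrSchild.Background.tEnergyDensity_eq`. [cite: Aretakis2012, §5.1] -/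
theorem neg_tCurrent_zero_eq (M a : ℝ) (w : E4 → ℝ) (x : E4) :
    -tCurrent M a w x 0 =
      2⁻¹ * (1 + 2 * scalarH M a x) * fderiv ℝ w x (E4.basisVector 0) ^ 2 +
        2⁻¹ * (fderiv ℝ w x (E4.basisVector 1) ^ 2 + fderiv ℝ w x (E4.basisVector 2) ^ 2 +
          fderiv ℝ w x (E4.basisVector 3) ^ 2) -
        scalarH M a x * (nullCovectorFun a x 1 * fderiv ℝ w x (E4.basisVector 1) +
          nullCovectorFun a x 2 * fderiv ℝ w x (E4.basisVector 2) +
          nullCovectorFun a x 3 * fderiv ℝ w x (E4.basisVector 3)) ^ 2 := by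
  simp only [tCurrent, inverseMetric_apply, Fin.sum_univ_four, Fin.isValue, nullVector_apply_zero,
    nullVector_apply_one, nullVector_apply_two, nullVector_apply_three]
  simp only [show (1 : Fin 4) ≠ 0 from by decide, show (2 : Fin 4) ≠ 0 from by decide,
    show (3 : Fin 4) ≠ 0 from by decide, show (0 : Fin 4) ≠ 1 from by decide,
    show (0 : Fin 4) ≠ 2 from by decide, show (0 : Fin 4) ≠ 3 from by decide,
    show (1 : Fin 4) ≠ 2 from by decide, show (1 : Fin 4) ≠ 3 from by decide,
    show (2 : Fin 4) ≠ 1 from by decide, show (2 : Fin 4) ≠ 3 from by decide,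
    show (3 : Fin 4) ≠ 1 from by decide, show (3 : Fin 4) ≠ 2 from by decide,
    if_true, if_false]
  ring

/-! ### The Cauchy–Schwarz inequality of an axisymmetric covector against `ℓ⃗` -/

/-- `|u⃗|² = Σ/(r² + a²)` for `u⃗ = (r x₁/(r² + a²), r x₂/(r² + a²), x₃/r)`, the part of `ℓ⃗`
orthogonal to `∂_{φ*}`: `r²(x₁² + x₂²)/(r² + a²)² + x₃²/r² = Σ/(r² + a²)` wherever `r > 0` (from
`x₁² + x₂² = (r² + a²)(r² − x₃²)/r²` and `r²Σ = r⁴ + a²x₃²`). Visser arXiv:0706.0622, (35).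
[folklore] -/
theorem normSq_orthAxialPart {a : ℝ} {x : E4} (hx : 0 < radius a x) :
    (radius a x * x 1 / (radius a x ^ 2 + a ^ 2)) ^ 2 +
        (radius a x * x 2 / (radius a x ^ 2 + a ^ 2)) ^ 2 + (x 3 / radius a x) ^ 2 =
      blSigma a (E4.spatial x) / (radius a x ^ 2 + a ^ 2) := by
  have h12 := sq_add_sq_eq a hx
  have hS := sq_mul_blSigma_spatial a x
  have hr : radius a x ≠ 0 := hx.ne'
  have hA : radius a x ^ 2 + a ^ 2 ≠ 0 := by positivity
  rw [div_pow, div_pow, div_pow, mul_pow, mul_pow, ← add_div, ← mul_add, h12]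
  field_simp
  linear_combination (-1 : ℝ) * hS

/-- **Cauchy–Schwarz for axisymmetric covectors** (the inequality behind Aretakis's Prop. 5.1.1):
if `x₁ p₂ = x₂ p₁` then `(r² + a²) (ℓ⃗ · p⃗)² ≤ Σ |p⃗|²`, where `ℓ⃗ = (ℓ₁, ℓ₂, ℓ₃)` is the spatial
part of the Kerr–Schild null covector and `Σ = r² + a²x₃²/r²`. Proof: under the constraint
`ℓ⃗ · p⃗ = u⃗ · p⃗` with `u⃗ = (r x₁/(r² + a²), r x₂/(r² + a²), x₃/r)` (the `a`-terms of `ℓ₁`, `ℓ₂`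
cancel), `|u⃗|² = Σ/(r² + a²)` (`normSq_orthAxialPart`) and `(u⃗ · p⃗)² ≤ |u⃗|² |p⃗|²`.
[cite: Aretakis2012, §5.1, Prop. 5.1.1 (proof)] -/
theorem sq_nullSpatial_le_of_axisymmetric {a : ℝ} {x : E4} (hx : 0 < radius a x) {p₁ p₂ p₃ : ℝ}
    (hp : x 1 * p₂ - x 2 * p₁ = 0) :
    (radius a x ^ 2 + a ^ 2) *
        (nullCovectorFun a x 1 * p₁ + nullCovectorFun a x 2 * p₂ + nullCovectorFun a x 3 * p₃) ^ 2 ≤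
      blSigma a (E4.spatial x) * (p₁ ^ 2 + p₂ ^ 2 + p₃ ^ 2) := by
  have hr : radius a x ≠ 0 := hx.ne'
  have hA : 0 < radius a x ^ 2 + a ^ 2 := by positivity
  -- name the orthogonal part `u⃗`
  obtain ⟨u₁, hu₁⟩ : ∃ u₁, radius a x * x 1 / (radius a x ^ 2 + a ^ 2) = u₁ := ⟨_, rfl⟩
  obtain ⟨u₂, hu₂⟩ : ∃ u₂, radius a x * x 2 / (radius a x ^ 2 + a ^ 2) = u₂ := ⟨_, rfl⟩
  obtain ⟨u₃, hu₃⟩ : ∃ u₃, x 3 / radius a x = u₃ := ⟨_, rfl⟩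
  -- `ℓ⃗ · p⃗ = u⃗ · p⃗` under the constraint
  have hs : nullCovectorFun a x 1 * p₁ + nullCovectorFun a x 2 * p₂ + nullCovectorFun a x 3 * p₃ =
      u₁ * p₁ + u₂ * p₂ + u₃ * p₃ := by
    rw [nullCovectorFun_apply_one, nullCovectorFun_apply_two, nullCovectorFun_apply_three, ← hu₁,
      ← hu₂, ← hu₃]
    field_simp
    linear_combination (-(radius a x * a)) * hp
  -- `|u⃗|² = Σ/(r² + a²)`
  have hu : u₁ ^ 2 + u₂ ^ 2 + u₃ ^ 2 = blSigma a (E4.spatial x) / (radius a x ^ 2 + a ^ 2) := by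
    rw [← hu₁, ← hu₂, ← hu₃]; exact normSq_orthAxialPart hx
  have hS : blSigma a (E4.spatial x) = (radius a x ^ 2 + a ^ 2) * (u₁ ^ 2 + u₂ ^ 2 + u₃ ^ 2) := by
    rw [hu]; field_simp
  rw [hs, hS, mul_assoc]
  refine mul_le_mul_of_nonneg_left ?_ hA.le
  nlinarith [sq_nonneg (u₁ * p₂ - u₂ * p₁), sq_nonneg (u₁ * p₃ - u₃ * p₁),
    sq_nonneg (u₂ * p₃ - u₃ * p₂)]

/-! ### Prop. 5.1.1: the `T`-energy density of an axisymmetric field is non-negative on `{Δ ≥ 0}` -/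

/-- **Aretakis's Prop. 5.1.1 in quantitative form (degenerate coercivity of the `T`-energy for
axisymmetric fields).** On Kerr `g_{M,a}` with `M ≥ 0`, at a point with `r > 0`, for every `w` with
`Φw(x) = dw_x(x₁∂₂ − x₂∂₁) = 0`:
`½ (1 + 2H) (∂₀w)² + (Δ/(2 (r² + a²))) (∑_{i=1}^3 (∂_iw)²) ≤ −(J^T)⁰[w]`,
`Δ = r² − 2Mr + a²`. (The difference is `(Mr/((r² + a²)Σ)) (Σ|∇w|² − (r² + a²)(ℓ⃗·∇w)²) ≥ 0` by
`sq_nullSpatial_le_of_axisymmetric` and `2HΣ = 2Mr`.) For `a = M` the weight is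
`(r − M)²/(r² + M²)`: the printed `J^T_μ n^μ_Σ ∼ (Tψ)² + (1 − M/r)²(Yψ)² + |∇̸ψ|²` (lower half, with
the angular part also weighted). [cite: Aretakis2012, §5.1, Prop. 5.1.1 and the display following it] -/
theorem neg_tCurrent_zero_ge_of_axisymmetric {M a : ℝ} (hM : 0 ≤ M) {x : E4} (hx : 0 < radius a x)
    {w : E4 → ℝ} (hw : fderiv ℝ w x (axialVector x) = 0) :
    2⁻¹ * (1 + 2 * scalarH M a x) * fderiv ℝ w x (E4.basisVector 0) ^ 2 +
        (radius a x ^ 2 - 2 * M * radius a x + a ^ 2) / (2 * (radius a x ^ 2 + a ^ 2)) *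
          (fderiv ℝ w x (E4.basisVector 1) ^ 2 + fderiv ℝ w x (E4.basisVector 2) ^ 2 +
            fderiv ℝ w x (E4.basisVector 3) ^ 2) ≤
      -tCurrent M a w x 0 := by
  rw [neg_tCurrent_zero_eq, scalarH_eq_div_blSigma M a hx]
  rw [fderiv_axialVector] at hw
  have hCS := sq_nullSpatial_le_of_axisymmetric hx (p₃ := fderiv ℝ w x (E4.basisVector 3)) hw
  -- name the atoms
  obtain ⟨p₀, hp₀⟩ : ∃ p₀, fderiv ℝ w x (E4.basisVector 0) = p₀ := ⟨_, rfl⟩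
  obtain ⟨P, hP⟩ : ∃ P, fderiv ℝ w x (E4.basisVector 1) ^ 2 + fderiv ℝ w x (E4.basisVector 2) ^ 2 +
      fderiv ℝ w x (E4.basisVector 3) ^ 2 = P := ⟨_, rfl⟩
  obtain ⟨s, hs⟩ : ∃ s, nullCovectorFun a x 1 * fderiv ℝ w x (E4.basisVector 1) +
      nullCovectorFun a x 2 * fderiv ℝ w x (E4.basisVector 2) +
      nullCovectorFun a x 3 * fderiv ℝ w x (E4.basisVector 3) = s := ⟨_, rfl⟩
  obtain ⟨r, hr⟩ : ∃ r, radius a x = r := ⟨_, rfl⟩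
  obtain ⟨S, hS⟩ : ∃ S, blSigma a (E4.spatial x) = S := ⟨_, rfl⟩
  rw [hP, hs, hr, hS] at hCS ⊢
  rw [hp₀]
  have hrpos : 0 < r := hr ▸ hx
  have hSpos : 0 < S := hS ▸ blSigma_spatial_pos hx
  have hA : 0 < r ^ 2 + a ^ 2 := by positivity
  have key : 2⁻¹ * (1 + 2 * (M * r / S)) * p₀ ^ 2 + 2⁻¹ * P - M * r / S * s ^ 2 -
      (2⁻¹ * (1 + 2 * (M * r / S)) * p₀ ^ 2 + (r ^ 2 - 2 * M * r + a ^ 2) / (2 * (r ^ 2 + a ^ 2)) * P) =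
      M * r / ((r ^ 2 + a ^ 2) * S) * (S * P - (r ^ 2 + a ^ 2) * s ^ 2) := by
    field_simp
    ring
  have hnn : 0 ≤ M * r / ((r ^ 2 + a ^ 2) * S) * (S * P - (r ^ 2 + a ^ 2) * s ^ 2) :=
    mul_nonneg (div_nonneg (mul_nonneg hM hrpos.le) (mul_pos hA hSpos).le) (sub_nonneg.2 hCS)
  linarith

/-- **Aretakis's Prop. 5.1.1 (the `T`-energy density of an axisymmetric field through the
Kerr–Schild leaves is non-negative wherever `Δ(r) ≥ 0`).** On Kerr `g_{M,a}`, `M ≥ 0`, at a point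
with `r > 0` and `Δ(r) = r² − 2Mr + a² ≥ 0`, for every `w` with `Φw(x) = 0`: `0 ≤ −(J^T)⁰[w]`.
("If `ψ` is axisymmetric then the conserved energy flux corresponding to the Killing field `T` is
non-negative definite" — although `T` is spacelike in the ergoregion.)
[cite: Aretakis2012, §5.1, Prop. 5.1.1] -/
theorem neg_tCurrent_zero_nonneg_of_axisymmetric {M a : ℝ} (hM : 0 ≤ M) {x : E4}
    (hx : 0 < radius a x) (hΔ : 0 ≤ radius a x ^ 2 - 2 * M * radius a x + a ^ 2) {w : E4 → ℝ}
    (hw : fderiv ℝ w x (axialVector x) = 0) : 0 ≤ -tCurrent M a w x 0 := by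
  refine le_trans ?_ (neg_tCurrent_zero_ge_of_axisymmetric hM hx hw)
  have hH := scalarH_nonneg hM a x
  have hA : 0 < radius a x ^ 2 + a ^ 2 := by positivity
  positivity

/-- **Prop. 5.1.1 on and outside the event horizon**: for `|a| ≤ M`, `0 < M`, at every point with
`r ≥ r₊` (so `Δ = (r − r₊)(r − r₋) ≥ 0`), and every `w` with `Φw(x) = 0`, the `T`-energy density
through the leaf `{t* = x⁰}` is non-negative, `0 ≤ −(J^T)⁰[w]` — including the extremal case
`|a| = M` and the horizon sphere itself. [cite: Aretakis2012, §5.1, Prop. 5.1.1] -/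
theorem neg_tCurrent_zero_nonneg_of_rPlus_le {M a : ℝ} (hMa : |a| ≤ M) (hM : 0 < M) {x : E4}
    (hx : rPlus M a ≤ radius a x) {w : E4 → ℝ} (hw : fderiv ℝ w x (axialVector x) = 0) :
    0 ≤ -tCurrent M a w x 0 := by
  have hrp : M ≤ rPlus M a := by
    unfold rPlus; linarith [Real.sqrt_nonneg (M ^ 2 - a ^ 2)]
  have hr : 0 < radius a x := by linarith
  have ha2 : a ^ 2 ≤ M ^ 2 := by nlinarith [sq_abs a, abs_nonneg a]
  have hΔ : 0 ≤ radius a x ^ 2 - 2 * M * radius a x + a ^ 2 := by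
    rw [← sub_rPlus_mul_sub_rMinus ha2]
    exact mul_nonneg (sub_nonneg.2 hx) (sub_nonneg.2 ((rMinus_le_rPlus M a).trans hx))
  exact neg_tCurrent_zero_nonneg_of_axisymmetric hM.le hr hΔ hw

/-! ### The flux of `J^T` through the level sets of `r` and through the horizon -/

/-- `∂₀ r = 0`: the Kerr–Schild radius does not depend on `t*`. [cite: arXiv07060622, (35)] -/
private theorem fderiv_radius_basisVector_zero' {a : ℝ} {x : E4} (hx : 0 < radius a x) :
    fderiv ℝ (radius a) x (E4.basisVector 0) = 0 := by
  rw [(hasFDerivAt_radius hx).fderiv, ContinuousLinearMap.comp_apply]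
  have h0 : E4.spatial (E4.basisVector 0) = 0 := by
    ext i
    rw [E4.spatial_apply]
    simp [E4.basisVector, Fin.succ_ne_zero]
  rw [h0, map_zero]

/-- `ℓ⃗ · ∇r = 1` with the partial derivatives `∂_i r = dr(∂_i)`: `ℓ₁∂₁r + ℓ₂∂₂r + ℓ₃∂₃r = 1`
wherever `r > 0` (`Kerr.sum_nullCovectorFun_mul_radiusGradVec`). [cite: arXiv07060622, (34)–(35)] -/
theorem sum_nullCovectorFun_mul_fderiv_radius {a : ℝ} {x : E4} (hx : 0 < radius a x) :
    nullCovectorFun a x 1 * fderiv ℝ (radius a) x (E4.basisVector 1) +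
        nullCovectorFun a x 2 * fderiv ℝ (radius a) x (E4.basisVector 2) +
      nullCovectorFun a x 3 * fderiv ℝ (radius a) x (E4.basisVector 3) = 1 := by
  have h1 : fderiv ℝ (radius a) x (E4.basisVector 1) = radiusGradVec a (E4.spatial x) 0 := by
    rw [show (1 : Fin 4) = (0 : Fin 3).succ from rfl, fderiv_radius_basisVector_succ hx,
      radiusGradVec_apply, radius_ofTimeSpace_spatial]; rfl
  have h2 : fderiv ℝ (radius a) x (E4.basisVector 2) = radiusGradVec a (E4.spatial x) 1 := by
    rw [show (2 : Fin 4) = (1 : Fin 3).succ from rfl, fderiv_radius_basisVector_succ hx,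
      radiusGradVec_apply, radius_ofTimeSpace_spatial]; rfl
  have h3 : fderiv ℝ (radius a) x (E4.basisVector 3) = radiusGradVec a (E4.spatial x) 2 := by
    rw [show (3 : Fin 4) = (2 : Fin 3).succ from rfl, fderiv_radius_basisVector_succ hx,
      radiusGradVec_apply, radius_ofTimeSpace_spatial]; rfl
  rw [h1, h2, h3]
  exact sum_nullCovectorFun_mul_radiusGradVec hx

/-- **The flux of the `T`-current through the level sets of `r`.** For `r > 0` and every `w`,
`∑_μ (J^T)^μ ∂_μ r = ∂₀w · (2H (∂₀w − ℓ⃗·∇w) + ∇r · ∇w)`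
(`∂₀r = 0` kills the Lagrangian term; `∑_μ g^{μν} ∂_μ r = (2H, ∇r − 2H ℓ⃗)` by `ℓ⃗ · ∇r = 1`).
DRSR arXiv:1402.7034, §2.3.2 (fluxes through `{r = const}`); Aretakis, JFA 263 (2012), §5.1.
[cite: Aretakis2012, §5.1] -/
theorem sum_tCurrent_mul_fderiv_radius (M a : ℝ) {x : E4} (hx : 0 < radius a x) (w : E4 → ℝ) :
    ∑ μ, tCurrent M a w x μ * fderiv ℝ (radius a) x (E4.basisVector μ) =
      fderiv ℝ w x (E4.basisVector 0) *
        (2 * scalarH M a x * (fderiv ℝ w x (E4.basisVector 0) -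
            (nullCovectorFun a x 1 * fderiv ℝ w x (E4.basisVector 1) +
              nullCovectorFun a x 2 * fderiv ℝ w x (E4.basisVector 2) +
              nullCovectorFun a x 3 * fderiv ℝ w x (E4.basisVector 3))) +
          (fderiv ℝ (radius a) x (E4.basisVector 1) * fderiv ℝ w x (E4.basisVector 1) +
            fderiv ℝ (radius a) x (E4.basisVector 2) * fderiv ℝ w x (E4.basisVector 2) +
            fderiv ℝ (radius a) x (E4.basisVector 3) * fderiv ℝ w x (E4.basisVector 3))) := by
  have hl := sum_nullCovectorFun_mul_fderiv_radius hx
  have h0 := fderiv_radius_basisVector_zero' hx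
  -- name the atoms
  obtain ⟨p₀, hp₀⟩ : ∃ p₀, fderiv ℝ w x (E4.basisVector 0) = p₀ := ⟨_, rfl⟩
  obtain ⟨p₁, hp₁⟩ : ∃ p₁, fderiv ℝ w x (E4.basisVector 1) = p₁ := ⟨_, rfl⟩
  obtain ⟨p₂, hp₂⟩ : ∃ p₂, fderiv ℝ w x (E4.basisVector 2) = p₂ := ⟨_, rfl⟩
  obtain ⟨p₃, hp₃⟩ : ∃ p₃, fderiv ℝ w x (E4.basisVector 3) = p₃ := ⟨_, rfl⟩
  obtain ⟨n₁, hn₁⟩ : ∃ n₁, fderiv ℝ (radius a) x (E4.basisVector 1) = n₁ := ⟨_, rfl⟩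
  obtain ⟨n₂, hn₂⟩ : ∃ n₂, fderiv ℝ (radius a) x (E4.basisVector 2) = n₂ := ⟨_, rfl⟩
  obtain ⟨n₃, hn₃⟩ : ∃ n₃, fderiv ℝ (radius a) x (E4.basisVector 3) = n₃ := ⟨_, rfl⟩
  obtain ⟨l₁, hl₁⟩ : ∃ l₁, nullCovectorFun a x 1 = l₁ := ⟨_, rfl⟩
  obtain ⟨l₂, hl₂⟩ : ∃ l₂, nullCovectorFun a x 2 = l₂ := ⟨_, rfl⟩
  obtain ⟨l₃, hl₃⟩ : ∃ l₃, nullCovectorFun a x 3 = l₃ := ⟨_, rfl⟩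
  obtain ⟨h, hh⟩ : ∃ h, scalarH M a x = h := ⟨_, rfl⟩
  rw [hn₁, hn₂, hn₃, hl₁, hl₂, hl₃] at hl
  simp only [tCurrent, inverseMetric_apply, Fin.sum_univ_four, Fin.isValue, nullVector_apply_zero,
    nullVector_apply_one, nullVector_apply_two, nullVector_apply_three, h0, hp₀, hp₁, hp₂, hp₃,
    hn₁, hn₂, hn₃, hl₁, hl₂, hl₃, hh]
  simp only [show (1 : Fin 4) ≠ 0 from by decide, show (2 : Fin 4) ≠ 0 from by decide,
    show (3 : Fin 4) ≠ 0 from by decide, show (0 : Fin 4) ≠ 1 from by decide,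
    show (0 : Fin 4) ≠ 2 from by decide, show (0 : Fin 4) ≠ 3 from by decide,
    show (1 : Fin 4) ≠ 2 from by decide, show (1 : Fin 4) ≠ 3 from by decide,
    show (2 : Fin 4) ≠ 1 from by decide, show (2 : Fin 4) ≠ 3 from by decide,
    show (3 : Fin 4) ≠ 1 from by decide, show (3 : Fin 4) ≠ 2 from by decide,
    if_true, if_false]
  linear_combination (2 * h * p₀ * (p₀ - (l₁ * p₁ + l₂ * p₂ + l₃ * p₃))) * hl

/-- `∇r = ((r² + a²)/Σ) u⃗` componentwise: `∂₁r = r x₁/Σ`, `∂₂r = r x₂/Σ`,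
`∂₃r = (r² + a²) x₃/(rΣ)`. [cite: arXiv07060622, (35)] -/
theorem fderiv_radius_basisVector_eq_orthAxialPart {a : ℝ} {x : E4} (hx : 0 < radius a x) :
    fderiv ℝ (radius a) x (E4.basisVector 1) = radius a x * x 1 / blSigma a (E4.spatial x) ∧
      fderiv ℝ (radius a) x (E4.basisVector 2) = radius a x * x 2 / blSigma a (E4.spatial x) ∧
        fderiv ℝ (radius a) x (E4.basisVector 3) =
          (radius a x ^ 2 + a ^ 2) * x 3 / (radius a x * blSigma a (E4.spatial x)) := by
  have hr : radius a x ≠ 0 := hx.ne'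
  have hS : blSigma a (E4.spatial x) ≠ 0 := (blSigma_spatial_pos hx).ne'
  refine ⟨?_, ?_, ?_⟩
  · rw [fderiv_radius_basisVector_one hx]; field_simp
  · rw [fderiv_radius_basisVector_two hx]; field_simp
  · rw [fderiv_radius_basisVector_three hx]; ring

/-- **The `T`-flux through the horizon is `2H (Tw)(Kw)`.** For `|a| ≤ M`, `0 < M`, at a point of
the event horizon `{r = r₊}` and for every `w`,
`∑_μ (J^T)^μ ∂_μ r = 2H · ∂₀w · dw(K)`, `K = T + ω₊Φ = ∂₀ + (a/(2Mr₊))(x₁∂₂ − x₂∂₁)` the Hawking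
field (`Kerr.hawkingVector`): on `𝓗⁺` the vector `g♯dr` is `2H K`, the null generator
(`r₊² + a² = 2Mr₊`, so `∇r = 2H u⃗` and `∇r − 2Hℓ⃗ = 2H ω₊ (−x₂, x₁, 0)` there). DRSR
arXiv:1402.7034, §2.2.2 and §2.3.2 (`J^T_μ n^μ_{𝓗⁺} = (Tψ)(Kψ)`-type horizon fluxes); Aretakis,
JFA 263 (2012), §5.1. [cite: Aretakis2012, §5.1 (the horizon flux)] -/
theorem sum_tCurrent_mul_fderiv_radius_of_radius_eq_rPlus {M a : ℝ} (hMa : |a| ≤ M) (hM : 0 < M)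
    {x : E4} (hx : radius a x = rPlus M a) (w : E4 → ℝ) :
    ∑ μ, tCurrent M a w x μ * fderiv ℝ (radius a) x (E4.basisVector μ) =
      2 * scalarH M a x * fderiv ℝ w x (E4.basisVector 0) * fderiv ℝ w x (hawkingVector M a x) := by
  have hrp : 0 < rPlus M a := by
    unfold rPlus; linarith [Real.sqrt_nonneg (M ^ 2 - a ^ 2)]
  have hr : 0 < radius a x := hx ▸ hrp
  have hA := rPlus_sq_add_sq hMa
  rw [sum_tCurrent_mul_fderiv_radius M a hr w]
  have hK : fderiv ℝ w x (hawkingVector M a x) =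
      fderiv ℝ w x (E4.basisVector 0) + horizonAngularVelocity M a *
        (x 1 * fderiv ℝ w x (E4.basisVector 2) - x 2 * fderiv ℝ w x (E4.basisVector 1)) := by
    rw [hawkingVector, map_add, map_smul, fderiv_axialVector, smul_eq_mul]
  rw [hK, horizonAngularVelocity]
  obtain ⟨hn₁, hn₂, hn₃⟩ := fderiv_radius_basisVector_eq_orthAxialPart hr
  rw [hn₁, hn₂, hn₃, nullCovectorFun_apply_one, nullCovectorFun_apply_two,
    nullCovectorFun_apply_three, scalarH_eq_div_blSigma M a hr, hx]
  -- name the atoms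
  obtain ⟨p₀, hp₀⟩ : ∃ p₀, fderiv ℝ w x (E4.basisVector 0) = p₀ := ⟨_, rfl⟩
  obtain ⟨p₁, hp₁⟩ : ∃ p₁, fderiv ℝ w x (E4.basisVector 1) = p₁ := ⟨_, rfl⟩
  obtain ⟨p₂, hp₂⟩ : ∃ p₂, fderiv ℝ w x (E4.basisVector 2) = p₂ := ⟨_, rfl⟩
  obtain ⟨p₃, hp₃⟩ : ∃ p₃, fderiv ℝ w x (E4.basisVector 3) = p₃ := ⟨_, rfl⟩
  obtain ⟨S, hS⟩ : ∃ S, blSigma a (E4.spatial x) = S := ⟨_, rfl⟩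
  obtain ⟨R, hR⟩ : ∃ R, rPlus M a = R := ⟨_, rfl⟩
  rw [hp₀, hp₁, hp₂, hp₃, hS]
  rw [hR] at hA hrp ⊢
  have hSne : S ≠ 0 := hS ▸ (blSigma_spatial_pos hr).ne'
  have hRne : R ≠ 0 := hrp.ne'
  have hMne : M ≠ 0 := hM.ne'
  rw [hA]
  field_simp
  ring

/-- **The `T`-flux of an axisymmetric field through the horizon is `2H (∂₀w)² ≥ 0`** (Aretakis:
"similarly, we obtain `∫_{𝓗⁺} J^T_μ[ψ] n^μ_{𝓗⁺} ≥ 0`"). For `|a| ≤ M`, `0 < M`, at a point with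
`r = r₊` and `w` with `Φw(x) = 0`: `∑_μ (J^T)^μ ∂_μ r = 2H (∂₀w)²` and it is `≥ 0`. With the
outward conormal `−dr` of the exterior `{r > r₊}` along `𝓗⁺` this is the statement that the
horizon term of the `T`-energy identity on `{r ≥ r₊} ∩ {τ₁ ≤ t* ≤ τ₂}` is an energy *loss*, so
that the degenerate `T`-energy of axisymmetric solutions through the leaves is non-increasing
(Prop. 5.1.2). [cite: Aretakis2012, §5.1, the horizon flux and Prop. 5.1.2] -/
theorem sum_tCurrent_mul_fderiv_radius_of_axisymmetric {M a : ℝ} (hMa : |a| ≤ M) (hM : 0 < M)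
    {x : E4} (hx : radius a x = rPlus M a) {w : E4 → ℝ} (hw : fderiv ℝ w x (axialVector x) = 0) :
    ∑ μ, tCurrent M a w x μ * fderiv ℝ (radius a) x (E4.basisVector μ) =
      2 * scalarH M a x * fderiv ℝ w x (E4.basisVector 0) ^ 2 := by
  rw [sum_tCurrent_mul_fderiv_radius_of_radius_eq_rPlus hMa hM hx w, hawkingVector, map_add,
    map_smul, hw, smul_zero, add_zero]
  ring

/-- The horizon `T`-flux of an axisymmetric field is non-negative: `0 ≤ ∑_μ (J^T)^μ ∂_μ r` at
every point with `r = r₊` (`|a| ≤ M`, `0 < M`, `Φw(x) = 0`).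
[cite: Aretakis2012, §5.1, the horizon flux] -/
theorem sum_tCurrent_mul_fderiv_radius_nonneg_of_axisymmetric {M a : ℝ} (hMa : |a| ≤ M)
    (hM : 0 < M) {x : E4} (hx : radius a x = rPlus M a) {w : E4 → ℝ}
    (hw : fderiv ℝ w x (axialVector x) = 0) :
    0 ≤ ∑ μ, tCurrent M a w x μ * fderiv ℝ (radius a) x (E4.basisVector μ) := by
  rw [sum_tCurrent_mul_fderiv_radius_of_axisymmetric hMa hM hx hw]
  have hH := scalarH_nonneg hM.le a x
  positivity

end Literature.Geometry.Lorentzian.Kerr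

end
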